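import Summits.BirchSwinnertonDyer.Rank1Residual.X2.NonsplitHalvesOnTreeInt
import Summits.BirchSwinnertonDyer.Rank1Residual.X2.NonsplitCellCNotGVClass
import Summits.BirchSwinnertonDyer.Rank1Residual.X11b.IntSeriesValueRigidityOneSided
import Summits.BirchSwinnertonDyer.Rank1Residual.X11b.RouteR1LogOmega
import Summits.BirchSwinnertonDyer.Rank1Residual.Partition.AnticyclotomicControlJSWEmbAt
import Summits.BirchSwinnertonDyer.Rank1Residual.X2.NonsplitBDPValueDisplayPNew
import HarnessLib

/-!
# O9 ∩ {non-split} at `p ≥ 5`, CLASS LEVEL: the value half c2 DISCHARGED from print — [cas-split]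
# Thms. 2.10–2.11 in BDP 2013's display (`thm210_thm211_bdpDisplay_pNew`) + the kernel rescaling
# `continuousDisplay_pNew_of_bdpDisplay` + Hsieh 2014 Thm. 1 + the X11b cell's one-sided value rigidity
# across periods; the ¬split half of crux 4 at `p ≥ 5` then reads PUBLISHED facts + c3♭ + [Mazur's MC
# on X2b ∩ {non-split}] (cell `bsd-eis`, seat `bsd-eis-k5-c4`; route `EisensteinPrimes`, crux 4
# `BSDpOnCellC`, line b1, atom c2¬split, RULINGS L8 (d) / L11 (O2))

HONEST FRAMING (cell `bsd-eis`): theorems only; nothing booked; X2 stays CONSTRUCTION-SHAPED; no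
label moves. `X2/NonsplitCellCClassInt.lean` reads the NON-SPLIT half of crux 4 over the wide
receptacle as: PUBLISHED facts + c2♭ `NonsplitBDPValueOnTreeInt` + c3♭ `NonsplitIMCEqOnTreeInt` +
[Mazur's MC on X2b ∩ {non-split}]. At `p ≥ 5` the value half c2♭ is not needed AS A HYPOTHESIS: at the
admissible field `K` of the (b1) road (odd `d_K < −4`, Heegner for `N_E`, `L(E^{d_K},1) ≠ 0` —
Hoffstein–Luo) the BDP `p`-adic `L`-function of the `p`-new newform of `E` is PRINTED as a continuous
function on characters with its value at `𝟙` ([cas-split] = Castella JIMJ 17 Thms. 2.10–2.11, `a_p`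
symbolic, no image hypothesis; Literature fact `Castella2018Exceptional.thm210_thm211_bdpDisplay_pNew`
in BDP 2013's own display, turned into the continuous-function display with virtual periods by the
KERNEL theorem `continuousDisplay_pNew_of_bdpDisplay` of `X2/NonsplitBDPValueDisplayPNew.lean` — reading
(R2) of k5-c4-MEMO-1 is a theorem there), and a value theorem in that currency transfers to EVERY ♭-frame of
the same `(ι', 𝔭, κ, γ, f)` — in particular to Hsieh's (`exists_isBDPLFunctionInt_of_hsieh2014_of_classX2`)
— by the X11b cell's ONE-SIDED VALUE RIGIDITY ACROSS PERIODS
(`X11b.intSeries_constantCoeff_eq_of_isBDPLFunctionInt_of_continuousValues`, multr1-p2 gen 25; the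
character supply accumulating at `𝟙` is the theorem `X11b.exists_interpolationSupply_pow`; `c ≠ 0` by
`a_p = ±1` and `log_{ω_E} P ≠ 0` for `P` of infinite order). Reading the Heegner point through
`w₀.embedding` (the datum is produced that way) no Galois-conjugation transport is needed.

* `bsdp_of_cellC_of_not_split_of_manin_of_pNewValue_of_imcInt_of_partner` — pointwise, partner-supply
  form, at a pair with a Manin datum prime to `p`, `5 ≤ p`: `BSD(E,p)` from PUBLISHED facts (incl. the
  two named analytic facts Hsieh 2014 Thm. 1 `hH` and [cas-split] `hCS`), c3♭ at the pair, and the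
  partner supply.
* **`bsdp_of_cellC_of_not_split_of_pNewValue_of_imcInt`** — CLASS LEVEL, `5 ≤ p`:
  `∀ W p, 5 ≤ p → CellC W p → ¬ split → BSDp W p` ⇐ PUBLISHED facts + c3♭ (at every non-split CellC
  pair) + Mazur's MC on X2b ∩ {non-split}. NO c1, NO c2.
* **`bsdp_of_cellCNonsplitNotGV_of_pNewValue_of_imcInt`** — the ψ-even sub-cell at `5 ≤ p` (93 @5,
  17 @7 classes): PUBLISHED facts + c3♭ only.

So at `p ≥ 5` the NON-SPLIT half of crux 4 reads: PUBLISHED facts + c3♭ + [Mazur's MC on X2b ∩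
{non-split}]; at `p = 3` (2 552 + 2 830 non-split cells) the value half stays typed
(`NonsplitBDPValueSomeFrameOnTreeInt W 3`, `X2/NonsplitHalvesIntRigidity.lean`). CONDITIONAL on every
listed binder (c3♭ = Keller–Yin Thm. D shape, PREPRINT with the L1754 gap; the [cas-split] fact carries
readings (R1), (R-top), (R-w), (R3) — (R2) is the kernel theorem); nothing booked; no label change.

References: [Castella2018Exceptional] Thms. 2.10–2.11, Prop. 2.7; [Castella2018] Thm. 3.2, (3.2)–(3.3);
[Hsieh2014] Thm. 1; [BertoliniDarmonPrasanna2013] §5.2; [KellerYin2024] Thm. D (PRE);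
[CastellaEtAl2021] Thm. 5.3.1; [Mazur1978] Cor. 4.1; [MilneADT2006] Thm. I.7.3; [Miller2011LMS] Def. 1.1.
-/

set_option autoImplicit false

noncomputable section

open scoped Classical MatrixGroups ModularForm Topology

open Filter CongruenceSubgroup WeierstrassCurve NumberField IsDedekindDomain Field PowerSeries
  Literature.NumberTheory.EllipticCurves Literature.NumberTheory.EllipticCurves.GreenbergSelmer
  Literature.NumberTheory.EllipticCurves.ModularForms Literature.NumberTheory.QuadraticFields
  Literature.NumberTheory.EllipticCurves.Rank1Residual
  Literature.NumberTheory.EllipticCurves.Rank1Residual.Typed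
  Literature.NumberTheory.EllipticCurves.KrizLi2019
  Literature.NumberTheory.EllipticCurves.GreenbergVatsal2000
  Literature.NumberTheory.EllipticCurves.Wuthrich2014
  Literature.NumberTheory.EllipticCurves.SteinWuthrich2013
  Literature.NumberTheory.EllipticCurves.Castella2018
  Literature.NumberTheory.EllipticCurves.Castella2018Exceptional
  Literature.NumberTheory.GaloisRepresentations Literature.NumberTheory.GaloisCohomology
  Literature.NumberTheory.Automorphic
  Summit.BirchSwinnertonDyer.Rank1Residual.X11b.AcSelmer
  Summit.BirchSwinnertonDyer.Rank1Residual.X11b.Halves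
  Summit.BirchSwinnertonDyer.Rank1Residual.X11b

namespace Summit.BirchSwinnertonDyer.Rank1Residual.X2

/-! ### Pointwise at `p ≥ 5`: the value half from print at the datum's frame -/

section Pointwise

variable (W : WeierstrassCurve ℚ) [W.IsElliptic] [W.IsGloballyMinimal] (p : ℕ) [Fact p.Prime]

/-- **X2c ∩ {non-split}, `p ≥ 5`, pointwise with a Manin datum, partner-supply form — c2 FROM PRINT.**
`bsdp_of_cellC_of_not_split_of_manin_of_intResiduals_of_partner` (`X2/NonsplitCellCClassInt.lean`) with
the hypothesis `h2 : NonsplitBDPValueOnTreeInt W p` REPLACED by the Literature fact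
`thm210_thm211_bdpDisplay_pNew` ([cas-split] Thms. 2.10–2.11 in BDP's display, `p ≥ 5`, `p`-new, no image
hypothesis) and `5 ≤ p`. The datum is produced as there (Hoffstein–Luo field with ODD `d_K < −4`,
Heegner datum, `P` read through `w₀.embedding`, non-torsion by Gross–Zagier, Néron twist, `htamK`,
anticyclotomic `(κ, γ)`, degree-one `𝔭`); the frame is Hsieh's at an embedding datum `ι'` inducing `𝔭`
(`X11b.exists_datum_forall_mem_iff`, `exists_isBDPLFunctionInt_of_hsieh2014_of_classX2`, `f = Dt.f`);
c3♭ is instantiated at it; its VALUE at `𝟙` is the printed one by one-sided ♭-V1RIG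
(`X11b.intSeries_constantCoeff_eq_of_isBDPLFunctionInt_of_continuousValues`; `c ≠ 0` by
`X11b.R1.not_dvd_lFunction_of_mult` and `X11b.R1.logOmega_ne_zero`); then
`imcWaldspurgerOnTreeAt_of_intHalves_of_not_split_of_rankOne` and p398550's
`bsdp_of_cellC_of_not_split_of_imcWaldspurgerOnTree_of_partner`. CONDITIONAL on every listed binder;
nothing booked. [cite: Castella2018Exceptional, Thm. 2.10 and Thm. 2.11 (arXiv:1507.04260 pp. 13–14)]
[cite: Hsieh2014, Thm. 1 (arXiv:1112.1580 pp. 3–4)] [claim: KellerYin2024, status: under-review]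
[cite: CastellaEtAl2021, Thm. 5.3.1 and (5.5)–(5.7)] [cite: Miller2011LMS, Def. 1.1] -/
theorem bsdp_of_cellC_of_not_split_of_manin_of_pNewValue_of_imcInt_of_partner
    (hnf : exists_isNewformOf)
    (hPT : ∀ (K : Type) [Field K] [NumberField K], poitouTate_selmerStructure_duality K)
    (hPT2 : ∀ (K : Type) [Field K] [NumberField K], poitouTate_sha_tateDual K)
    (hEP : ∀ (K : Type) [Field K] [NumberField K] (v : HeightOneSpectrum (𝓞 K)),
      localEulerPoincareCharacteristic (v.adicCompletion K))
    (hcd : fieldCdLE_two_of_numberField)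
    (hBr : ∀ (K : Type) [Field K] [NumberField K] (p : ℕ) [Fact p.Prime],
      ZpExtension.decomp_not_le_kerSubgroup_of_isAnticyclotomic K p)
    (hH : hsieh2014_exists_anticyclotomicPAdicLFunction)
    (hCS : thm210_thm211_bdpDisplay_pNew)
    (hGZ : ∀ (N : ℕ) [NeZero N] (W : WeierstrassCurve ℚ) (K : Type) [Field K] [NumberField K],
      gross_zagier N W K)
    (hKo : ∀ (N : ℕ) [NeZero N] (W : WeierstrassCurve ℚ) (K : Type) [Field K] [NumberField K],
      kolyvagin N W K)
    (hHP : ∀ (N : ℕ) [NeZero N] (W : WeierstrassCurve ℚ) (K : Type) [Field K] [NumberField K],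
      heegnerPointComplex_mem_range_map N W K)
    (hGZK : rank_eq_analyticRank_of_analyticRank_le_one)
    (hHL : HoffsteinLuo1997_exists_twist_L_one_ne_zero)
    (hp5 : 5 ≤ p) (hc : CellC W p) (hns : ¬ W.HasSplitMultiplicativeReductionAtPrime p)
    (hMan : HasPrimeToManinDatum W p) (h3 : NonsplitIMCEqOnTreeInt W p)
    (hpartner : ∀ (K : Type) [Field K] [NumberField K], IsImaginaryQuadratic K →
        Odd (NumberField.discr K) → NumberField.discr K < -4 →
        SatisfiesHeegnerHypothesis (W.conductorNorm ℤ) K → SatisfiesHeegnerHypothesis p K →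
        (W.quadraticTwist (NumberField.discr K : ℚ)).entireLFunction 1 ≠ 0 →
      ∀ (Wd : WeierstrassCurve ℚ) [Wd.IsElliptic] [Wd.IsGloballyMinimal],
        (∃ C : VariableChange ℚ, C • Wd = W.quadraticTwist (NumberField.discr K : ℚ)) →
        Wd.analyticRank = 0 → PPartRankZero Wd p) :
    BSDp W p := by
  have hp : p.Prime := Fact.out
  have hmod : hasEntireLFunction_rat := WeierstrassCurve.hasEntireLFunction_rat_of_exists_isNewformOf hnf
  obtain ⟨hr, hp2, hred, hmult⟩ := hc
  haveI : NeZero (W.conductorNorm ℤ) := ⟨(W.conductorNorm_pos_holds).ne'⟩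
  -- `w(E) = -1`
  have hw : W.rootNumber = -1 := by
    rw [WeierstrassCurve.rootNumber_eq_neg_one_pow_analyticRank_of_exists_isNewformOf hnf W, hr]
    norm_num
  -- the admissible auxiliary field (odd `d_K < -4`, Heegner for `N_E`, `L(E^{d_K},1) ≠ 0`)
  obtain ⟨K, _, _, hK, hodd, hlt, hHN, hHp, hLK⟩ :=
    exists_admissibleField_of_rootNumber_eq_neg_one hnf hHL W hw p
  -- the datum with `p ∤ c`, a Heegner datum and the `K`-rational Heegner point READ THROUGH `w₀`
  obtain ⟨Dt, hcM⟩ := hMan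
  obtain ⟨β, hβ⟩ := exists_dvd_sq_sub_discr_holds (W.conductorNorm ℤ) K hK hHN
  obtain ⟨H, -⟩ := nonempty_heegnerDatum_holds (W.conductorNorm ℤ) K hK hβ
  obtain ⟨w₀⟩ := (inferInstance : Nonempty (InfinitePlace K))
  obtain ⟨P, hP⟩ := hHP (W.conductorNorm ℤ) W K hK hHN Dt H w₀.embedding
  -- the Heegner point has infinite order: `L'(E/K,1) = L'(E,1)·L(E^K,1) ≠ 0` (Gross–Zagier)
  have hL0 : W.entireLFunction 1 = 0 := entireLFunction_one_eq_zero_of_analyticRank_eq_one hr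
  obtain ⟨-, hderiv⟩ := leadingLCoeff_eq_deriv_of_analyticRank_eq_one hr
  have hLKd : LDerivEK W K ≠ 0 := by
    rw [lDerivEK_eq_deriv_mul W K hmod hL0]
    exact mul_ne_zero hderiv hLK
  have hPH : IsHeegnerPoint (W.conductorNorm ℤ) W K P := ⟨Dt, H, w₀.embedding, hP⟩
  have hPinf : ¬ IsOfFinAddOrder P :=
    (lDerivEK_ne_zero_iff_not_isOfFinAddOrder W (W.conductorNorm ℤ) K (hGZ _ W K) hK hHN hPH).mp hLKd
  -- a globally minimal model of the twist (Néron) and its transport values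
  have hD0 : (NumberField.discr K : ℚ) ≠ 0 := by exact_mod_cast NumberField.discr_ne_zero K
  haveI hEt : (W.quadraticTwist (NumberField.discr K : ℚ)).IsElliptic :=
    W.isElliptic_quadraticTwist hD0
  obtain ⟨Cd, hCd⟩ := hasGlobalMinimalModel_rat_holds (W.quadraticTwist (NumberField.discr K : ℚ))
  set Wd : WeierstrassCurve ℚ := Cd • W.quadraticTwist (NumberField.discr K : ℚ) with hWd_def
  haveI : Wd.IsGloballyMinimal := hCd
  have hWd : Cd • W.quadraticTwist (NumberField.discr K : ℚ) = Wd := rfl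
  have hC : Cd⁻¹ • Wd = W.quadraticTwist (NumberField.discr K : ℚ) := by
    rw [← hWd, inv_smul_smul]
  obtain ⟨htam, hu⟩ := twistTransportPackage_holds W p K Wd Cd ⟨hr, hp2, hred, hmult⟩ hK hodd hHN hWd
  have htamK : padicValNat p (W.baseChange K).tamagawaProduct = 2 * padicValNat p W.tamagawaProduct :=
    padicValNat_tamagawaProduct_baseChange_of_heegner_odd W p hp2 K hK hodd hHN hHp
  -- the twist has analytic rank `0`; its rank-zero `p`-part from the supply
  have hLd : Wd.entireLFunction 1 ≠ 0 := by
    rw [← hWd, entireLFunction_smul]; exact hLK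
  have hrd : Wd.analyticRank = 0 := (Wd.analyticRank_eq_zero_iff_holds (hmod _)).2 hLd
  have htw : PPartRankZero Wd p := hpartner K hK hodd hlt hHN hHp hLK Wd ⟨Cd⁻¹, hC⟩ hrd
  -- the anticyclotomic `ℤ_p`-extension, a topological generator, a degree-one prime above `p`
  haveI : IsTotallyComplex K := hK.2
  obtain ⟨κ, hκ⟩ := ZpExtension.exists_isAnticyclotomic_holds (K := K) (p := p) hK.1
    (fun w ↦ IsTotallyComplex.isComplex w)
  obtain ⟨γ, hγ⟩ := κ.surjective (Multiplicative.ofAdd 1)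
  haveI : Fact (κ.IsTopGenerator γ) := ⟨hγ⟩
  have hpN : p ∣ W.conductorNorm ℤ := X11b.dvd_conductorNorm_of_mult (W := W) hmult
  have hp2N : ¬ p ^ 2 ∣ W.conductorNorm ℤ := not_sq_dvd_conductorNorm_of_mult W p hmult
  obtain ⟨𝔭, h𝔭, he, hf⟩ := X11b.exists_degreeOnePrime_of_splitsIn K p hK.1 (hHp p hp dvd_rfl)
  -- an embedding datum inducing `𝔭`, Hsieh's ♭-frame there (for the newform `Dt.f`), c3♭ at it
  obtain ⟨ι₀⟩ := PadicAlgCl.nonempty_ringEquiv_complex p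
  obtain ⟨ι', -, hι'⟩ := X11b.exists_datum_forall_mem_iff p ι₀ hK h𝔭
  obtain ⟨ΩK', Ωp', Q, hΩK', hΩp', hQ⟩ := exists_isBDPLFunctionInt_of_hsieh2014_of_classX2 W p hH ι' 𝔭
    κ γ Dt.isNewformOf ⟨hp2, hred, hmult⟩ rfl hK hHN h𝔭 hι' hκ hγ
  have hΩp0' : Ωp' ≠ 0 := fun h0 ↦ by rw [h0, norm_zero] at hΩp'; exact zero_ne_one hΩp'
  have h3Q : R1.IMCEqIntAt W p κ 𝔭 γ Q :=
    h3 (W.conductorNorm ℤ) K Dt H w₀.embedding P ⟨hr, hp2, hred, hmult⟩ hns rfl hK hlt hHN hLK hP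
      hcM hPinf κ hκ γ 𝔭 h𝔭 he hf Dt.f Dt.isNewformOf ι' hι' ΩK' Ωp' Q hΩK' hΩp' hQ
  -- the value at `𝟙` of `Q` from print: continuity display + one-sided value rigidity
  have hemb : ∀ k : 𝓞 K, k ∈ 𝔭.asIdeal ↔ ‖embAt K p 𝔭 h𝔭 he hf (k : K)‖ < 1 :=
    mem_asIdeal_iff_norm_embAt_lt_one 𝔭 h𝔭 he hf
  obtain ⟨ΩK₀, Ωp₀, u₀, hΩK₀, hΩp₀, hu₀, hcont⟩ := continuousDisplay_pNew_of_bdpDisplay hCS ι' W K 𝔭 κ γ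
    Dt H w₀ (embAt K p 𝔭 h𝔭 he hf)
    P hp5 rfl hpN hp2N hK hodd (hHN p hp hpN) h𝔭 hι' hHN hκ hγ hcM hP hemb
  have ha : ¬ (p : ℤ) ∣ W.LFunction p := X11b.R1.not_dvd_lFunction_of_mult Dt.isNewformOf hmult
  have hX : algebraMap ℚ_[p] ℂ_[p] (((1 : ℚ_[p]) - ((W.LFunction p : ℤ) : ℚ_[p]) * (p : ℚ_[p])⁻¹) *
      padicLogOmega W p (embAt K p 𝔭 h𝔭 he hf) P) ≠ 0 := by
    rw [map_ne_zero_iff _ (algebraMap ℚ_[p] ℂ_[p]).injective]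
    refine mul_ne_zero ?_ ?_
    · intro h0
      have h := X11b.R1.norm_one_sub_div_eq p ha
      rw [h0, norm_zero] at h
      have hp0 : (0 : ℝ) < p := by exact_mod_cast hp.pos
      exact absurd h (ne_of_lt hp0)
    · rw [← X11b.R1.logOmega_eq_padicLogOmega]
      exact X11b.R1.logOmega_ne_zero W p _ hPinf
  have hu₀0 : u₀ ≠ 0 := fun h0 ↦ by rw [h0, norm_zero] at hu₀; exact zero_ne_one hu₀
  have hc0 : u₀ * (algebraMap ℚ_[p] ℂ_[p] (((1 : ℚ_[p]) - ((W.LFunction p : ℤ) : ℚ_[p]) *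
      (p : ℚ_[p])⁻¹) * padicLogOmega W p (embAt K p 𝔭 h𝔭 he hf) P)) ^ 2 ≠ 0 :=
    mul_ne_zero hu₀0 (pow_ne_zero _ hX)
  have heq := X11b.intSeries_constantCoeff_eq_of_isBDPLFunctionInt_of_continuousValues hp2 hK hκ hγ
    hΩK₀ hΩK' hΩp₀ hΩp0' hcont hc0 hQ
  have h2Q : R1.BDPValueAtOneIntAt W p (embAt K p 𝔭 h𝔭 he hf) P Q (W.LFunction p) := by
    refine ⟨u₀, hu₀, ?_⟩
    rw [X11b.R1.logOmega_eq_padicLogOmega, ← heq]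
    exact X11b.R1.intSeries_hasValueAt_zero p Q
  -- the composite from the ♭ halves at `Q`, then the (b1) road's links
  have hIW := imcWaldspurgerOnTreeAt_of_intHalves_of_not_split_of_rankOne W p hGZK hnf hPT hPT2 hEP
    hcd hBr hp2 hmult hns hr hK (hHp p hp dvd_rfl) hLK P hPinf κ hκ γ 𝔭 h𝔭 he hf Q h3Q h2Q
  exact bsdp_of_cellC_of_not_split_of_imcWaldspurgerOnTree_of_partner hnf hPT hPT2 hEP hcd hBr W p
    (W.conductorNorm ℤ) K Dt H w₀.embedding P (hGZ _ W K) (hKo _ W K) hGZK ⟨hr, hp2, hred, hmult⟩ hns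
    rfl hK hlt hHN hHp hP hPinf hcM hLK Wd Cd hWd htw htam hu htamK κ hκ γ 𝔭 h𝔭 he hf hIW

end Pointwise

/-! ### Class level at `p ≥ 5`: PUBLISHED facts + c3♭ + [Mazur's MC on X2b ∩ {non-split}] -/

section ClassLevel

/-- **X2c ∩ {non-split} ⇒ `BSD(E,p)` at `p ≥ 5`, CLASS LEVEL, with the value half c2 FROM PRINT.**
`bsdp_of_cellC_of_not_split_of_intResiduals` (`X2/NonsplitCellCClassInt.lean`) with the hypothesis
`h2` REPLACED by `thm210_thm211_bdpDisplay_pNew` ([cas-split] Thms. 2.10–2.11) and `5 ≤ p`: for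
every rank-one X2 pair at a NON-split `p ≥ 5`, `BSD(E,p)` from the PUBLISHED named facts (incl. Hsieh
2014 Thm. 1 `hH`, [cas-split] `hCS`, Edixhoven `hEd`, Mazur 1978 `hMaz`, Cassels `hCassels`), c3♭ at
every non-split CellC pair (`h3` — Keller–Yin Thm. D shape, PREPRINT with the L1754 gap) and Mazur's
main conjecture at every X2b ∩ {non-split} pair (`hMCB`, crux 3's non-split half, used only at the
partner of a ψ-odd pair). NO c1, NO c2. Proof: the Manin condition is moved to the optimal curve
(`bsdp_of_cellC_of_forall_isIsogenous`); the partner is supplied by parity cases (`targetA_of_published`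
/ `bsdp_of_mazurMainConjectureAt_of_analyticRank_eq_zero`); then the pointwise theorem. CONDITIONAL on
every listed binder; nothing booked; X2 CONSTRUCTION-SHAPED; no label change.
[cite: Castella2018Exceptional, Thm. 2.10 and Thm. 2.11 (arXiv:1507.04260 pp. 13–14)]
[cite: Hsieh2014, Thm. 1 (arXiv:1112.1580 pp. 3–4)] [claim: KellerYin2024, status: under-review]
[cite: CastellaEtAl2021, Thm. 5.3.1] [cite: Mazur1978, Cor. 4.1] [cite: MilneADT2006, Thm. I.7.3]
[cite: Miller2011LMS, Def. 1.1] -/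
theorem bsdp_of_cellC_of_not_split_of_pNewValue_of_imcInt
    (hGV : lambdaMu_multiplicative_of_gvPar) (hWu : thm16_charIdeal_dvd_multiplicative_of_reducible)
    (hJs : thm61_splitMultiplicative) (hJn : thm61_nonsplitMultiplicative)
    (hHs : exists_isSplitMultCanonical) (hHn : exists_isMultCanonical)
    (hpar : nonempty_modularParametrizationData)
    (hGS : ∀ (W : WeierstrassCurve ℚ) [W.IsElliptic] [W.IsGloballyMinimal] (p : ℕ) [Fact p.Prime],
      greenberg_stevens (W := W) (p := p))
    (hnf : exists_isNewformOf)
    (hPT : ∀ (K : Type) [Field K] [NumberField K], poitouTate_selmerStructure_duality K)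
    (hPT2 : ∀ (K : Type) [Field K] [NumberField K], poitouTate_sha_tateDual K)
    (hEP : ∀ (K : Type) [Field K] [NumberField K] (v : HeightOneSpectrum (𝓞 K)),
      localEulerPoincareCharacteristic (v.adicCompletion K))
    (hcd : fieldCdLE_two_of_numberField)
    (hBr : ∀ (K : Type) [Field K] [NumberField K] (p : ℕ) [Fact p.Prime],
      ZpExtension.decomp_not_le_kerSubgroup_of_isAnticyclotomic K p)
    (hH : hsieh2014_exists_anticyclotomicPAdicLFunction)
    (hCS : thm210_thm211_bdpDisplay_pNew)
    (hGZ : ∀ (N : ℕ) [NeZero N] (W : WeierstrassCurve ℚ) (K : Type) [Field K] [NumberField K],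
      gross_zagier N W K)
    (hKo : ∀ (N : ℕ) [NeZero N] (W : WeierstrassCurve ℚ) (K : Type) [Field K] [NumberField K],
      kolyvagin N W K)
    (hHP : ∀ (N : ℕ) [NeZero N] (W : WeierstrassCurve ℚ) (K : Type) [Field K] [NumberField K],
      heegnerPointComplex_mem_range_map N W K)
    (hGZK : rank_eq_analyticRank_of_analyticRank_le_one)
    (hHL : HoffsteinLuo1997_exists_twist_L_one_ne_zero)
    (hEd : edixhoven_optimalManinConstant_integral) (hMaz : mazur_not_dvd_maninConstant_of_odd)
    (hCassels : bsdRHS_eq_of_isIsogenous)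
    (h3 : ∀ (W : WeierstrassCurve ℚ) [W.IsElliptic] [W.IsGloballyMinimal] (p : ℕ) [Fact p.Prime],
      CellC W p → ¬ W.HasSplitMultiplicativeReductionAtPrime p → NonsplitIMCEqOnTreeInt W p)
    (hMCB : ∀ (W : WeierstrassCurve ℚ) [W.IsElliptic] [W.IsGloballyMinimal] (p : ℕ) [Fact p.Prime],
      CellB W p → ¬ W.HasSplitMultiplicativeReductionAtPrime p → MazurMainConjectureAt W p)
    (W : WeierstrassCurve ℚ) [W.IsElliptic] [W.IsGloballyMinimal] (p : ℕ) [Fact p.Prime]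
    (hp5 : 5 ≤ p) (hc : CellC W p) (hns : ¬ W.HasSplitMultiplicativeReductionAtPrime p) :
    BSDp W p := by
  have hmod : hasEntireLFunction_rat := WeierstrassCurve.hasEntireLFunction_rat_of_exists_isNewformOf hnf
  refine bsdp_of_cellC_of_forall_isIsogenous hEd hMaz hCassels hpar hnf hGZK W p hc ?_
  intro W₀ _ _ hiso hc₀ hMan₀
  have hns₀ : ¬ W₀.HasSplitMultiplicativeReductionAtPrime p := fun h ↦
    hns (IsogenyQuotientLine.hasSplitMultiplicativeReductionAtPrime_of_isIsogenous
      hiso.symm_of_charZero h)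
  refine bsdp_of_cellC_of_not_split_of_manin_of_pNewValue_of_imcInt_of_partner W₀ p hnf hPT hPT2 hEP
    hcd hBr hH hCS hGZ hKo hHP hGZK hHL hp5 hc₀ hns₀ hMan₀ (h3 W₀ p hc₀ hns₀) ?_
  intro K _ _ hK _ _ _ hHp _ Wd _ _ hWd hrd
  obtain ⟨C, hC⟩ := hWd
  -- the twist is X2 and NON-split at `p`; its rank-zero `p`-part by parity cases
  have hXd : ClassX2 Wd p := classX2_twist W₀ p hc₀.2 K hK hHp Wd ⟨C, hC⟩
  have hnsd : ¬ Wd.HasSplitMultiplicativeReductionAtPrime p :=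
    not_hasSplitMultiplicativeReductionAtPrime_of_smul_eq_quadraticTwist W₀ Wd hK p hc₀.2.1 hc₀.2.2.2
      hns₀ hHp hC
  have hbsdd : BSDp Wd p := by
    by_cases hgv : GVPar Wd p
    · exact targetA_of_published hGV hWu hJs hJn hHs hHn hGZK hmod hpar hGS Wd p ⟨hrd, hXd, hgv⟩
    · exact bsdp_of_mazurMainConjectureAt_of_analyticRank_eq_zero hJs hJn hHs hHn hGZK hmod hpar Wd p
        (hGS Wd p) hXd.1 hXd.2.2 hrd (hMCB Wd p ⟨hrd, hXd, hgv⟩ hnsd)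
  exact pPartRankZero_of_pPart hGZK Wd p hrd (pPart_of_bsdp hmod hGZK Wd p (by omega) hbsdd)

/-- **The ψ-even non-split sub-cell `CellCNonsplitNotGV` at `p ≥ 5` (93 @5, 17 @7 classes), CLASS
LEVEL, from PUBLISHED facts + c3♭ ONLY — NO main-conjecture input, NO c1, NO c2.**
`bsdp_of_cellCNonsplitNotGV_of_intResiduals` (`X2/NonsplitCellCClassInt.lean`) with `h2` REPLACED by
the [cas-split] fact and `5 ≤ p`; the CGLS partner of a ψ-even pair lies in the CLOSED sub-cell X2a
(`pPartRankZero_twist_of_not_gvPar`; parity is an isogeny invariant at a multiplicative prime by the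
two Tate-uniformisation facts `hT`, `hT'`). CONDITIONAL on every listed binder; nothing booked; X2
CONSTRUCTION-SHAPED; no label change. [cite: Castella2018Exceptional, Thm. 2.10 and Thm. 2.11 (arXiv:1507.04260 pp. 13–14)]
[cite: GreenbergVatsal2000, Thm. (1.3) and §2 p. 28] [cite: SilvermanATAEC1994, Thm. V.5.3 and Cor. V.5.4]
[cite: Hsieh2014, Thm. 1 (arXiv:1112.1580 pp. 3–4)] [claim: KellerYin2024, status: under-review]
[cite: Miller2011LMS, Def. 1.1] -/
theorem bsdp_of_cellCNonsplitNotGV_of_pNewValue_of_imcInt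
    (hGV : lambdaMu_multiplicative_of_gvPar) (hWu : thm16_charIdeal_dvd_multiplicative_of_reducible)
    (hJs : thm61_splitMultiplicative) (hJn : thm61_nonsplitMultiplicative)
    (hHs : exists_isSplitMultCanonical) (hHn : exists_isMultCanonical)
    (hpar : nonempty_modularParametrizationData)
    (hGS : ∀ (W : WeierstrassCurve ℚ) [W.IsElliptic] [W.IsGloballyMinimal] (p : ℕ) [Fact p.Prime],
      greenberg_stevens (W := W) (p := p))
    (hnf : exists_isNewformOf)
    (hPT : ∀ (K : Type) [Field K] [NumberField K], poitouTate_selmerStructure_duality K)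
    (hPT2 : ∀ (K : Type) [Field K] [NumberField K], poitouTate_sha_tateDual K)
    (hEP : ∀ (K : Type) [Field K] [NumberField K] (v : HeightOneSpectrum (𝓞 K)),
      localEulerPoincareCharacteristic (v.adicCompletion K))
    (hcd : fieldCdLE_two_of_numberField)
    (hBr : ∀ (K : Type) [Field K] [NumberField K] (p : ℕ) [Fact p.Prime],
      ZpExtension.decomp_not_le_kerSubgroup_of_isAnticyclotomic K p)
    (hH : hsieh2014_exists_anticyclotomicPAdicLFunction)
    (hCS : thm210_thm211_bdpDisplay_pNew)
    (hGZ : ∀ (N : ℕ) [NeZero N] (W : WeierstrassCurve ℚ) (K : Type) [Field K] [NumberField K],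
      gross_zagier N W K)
    (hKo : ∀ (N : ℕ) [NeZero N] (W : WeierstrassCurve ℚ) (K : Type) [Field K] [NumberField K],
      kolyvagin N W K)
    (hHP : ∀ (N : ℕ) [NeZero N] (W : WeierstrassCurve ℚ) (K : Type) [Field K] [NumberField K],
      heegnerPointComplex_mem_range_map N W K)
    (hGZK : rank_eq_analyticRank_of_analyticRank_le_one)
    (hHL : HoffsteinLuo1997_exists_twist_L_one_ne_zero)
    (hEd : edixhoven_optimalManinConstant_integral) (hMaz : mazur_not_dvd_maninConstant_of_odd)
    (hCassels : bsdRHS_eq_of_isIsogenous)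
    (hT : Silverman1994_thmV53_tateUniformisation.{0})
    (hT' : Silverman1994_thmV53_corV54_tateUniformisation.{0})
    (h3 : ∀ (W : WeierstrassCurve ℚ) [W.IsElliptic] [W.IsGloballyMinimal] (p : ℕ) [Fact p.Prime],
      CellC W p → ¬ W.HasSplitMultiplicativeReductionAtPrime p → NonsplitIMCEqOnTreeInt W p)
    (W : WeierstrassCurve ℚ) [W.IsElliptic] [W.IsGloballyMinimal] (p : ℕ) [Fact p.Prime]
    (hp5 : 5 ≤ p) (hc : CellCNonsplitNotGV W p) : BSDp W p := by
  obtain ⟨hcC, hns, hnot⟩ := hc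
  have hmod : hasEntireLFunction_rat := WeierstrassCurve.hasEntireLFunction_rat_of_exists_isNewformOf hnf
  refine bsdp_of_cellC_of_forall_isIsogenous hEd hMaz hCassels hpar hnf hGZK W p hcC ?_
  intro W₀ _ _ hiso hc₀ hMan₀
  have hns₀ : ¬ W₀.HasSplitMultiplicativeReductionAtPrime p := fun h ↦
    hns (IsogenyQuotientLine.hasSplitMultiplicativeReductionAtPrime_of_isIsogenous
      hiso.symm_of_charZero h)
  have hnot₀ : ¬ GVPar W₀ p := fun h ↦
    hnot ((gvPar_iff_of_isIsogenous_of_mult hT hT' hcC.2.1 hcC.2.2.2 hiso).mpr h)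
  exact bsdp_of_cellC_of_not_split_of_manin_of_pNewValue_of_imcInt_of_partner W₀ p hnf hPT hPT2 hEP
    hcd hBr hH hCS hGZ hKo hHP hGZK hHL hp5 hc₀ hns₀ hMan₀ (h3 W₀ p hc₀ hns₀)
    (fun K _ _ hK _ _ _ hHp _ Wd _ _ hWd hrd ↦
      pPartRankZero_twist_of_not_gvPar hGV hWu hJs hJn hHs hHn hGZK hmod hpar hGS W₀ p hc₀.2 hnot₀ K
        hK hHp Wd hWd hrd)

end ClassLevel

end Summit.BirchSwinnertonDyer.Rank1Residual.X2

end
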